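import Summits.Ventures.PercRepro.SingleMergeSeven
import Summits.Ventures.PercRepro.CodeBoundKernel
import Summits.Ventures.PercRepro.LineC

/-!
# C-005 up to `n` edges from Lemma B up to `n` coordinates

`LemmaBSingleMergeUpTo n` is the statement *Lemma B holds for every monotone single-merge map on
at most `n` coordinates* (`crossCount cross4 c ≤ topBotCount c`).  It is a kernel theorem for
`n ≤ 8` (`lemmaBSingleMergeUpTo_eight`, from `crossCount_le_topBotCount_of_card_le_eight'`), and
`C005_of_card_le_of_lemmaB` turns it into **C-005 for every marked multigraph with at most `n`
edges at every weight vector** — the face argument of `C005_of_card_le_seven` with the dimension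
bound abstracted: every face map of a multigraph with `≤ n` edges is a single-merge map on `≤ n`
coordinates.

For `n = 9` the statement is not yet a kernel theorem: the three-type case has crossing pairs with
up to `18 > d + 1` members, outside the reach of the 8-point code bound.  It is established by two
independent SAT solvers on the symmetry-reduced encoding with DRAT certificates
(HOME/mining/p4/g5, jobs j164062/j164063/j164068/j164072, DRAT j164396/j164397), so
`C005_of_card_le_nine` records **C-005 for at most nine edges modulo the SAT certificate**, exactly
as `C005_of_card_le_eight` recorded the eight-edge case modulo `CodeBound8` before that bound was
proved.  The two-type case of every `n` is the column lemma; only three-type maps remain.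
-/

namespace PercRepro

open Finset

/-- **Lemma B for single-merge maps on at most `n` coordinates**: `crossCount cross4 c ≤ topBotCount c`
for every monotone single-merge map `c` on a coordinate type of cardinality `≤ n`. -/
def LemmaBSingleMergeUpTo (n : ℕ) : Prop :=
  ∀ {S : Type} [Fintype S] [DecidableEq S] (c : Config S → Setoid (Fin 4)),
    Monotone c → SingleMergeMap c → Fintype.card S ≤ n → crossCount cross4 c ≤ topBotCount c

/-- Lemma B up to `n` coordinates is monotone in `n`. -/
theorem LemmaBSingleMergeUpTo.mono {m n : ℕ} (hmn : m ≤ n) (h : LemmaBSingleMergeUpTo n) :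
    LemmaBSingleMergeUpTo m :=
  fun c hc hsm hcard => h c hc hsm (hcard.trans hmn)

/-- Lemma B for single-merge maps on at most eight coordinates is a kernel theorem
(the dimension lemma, the column lemma and the 8-point code bound). -/
theorem lemmaBSingleMergeUpTo_eight : LemmaBSingleMergeUpTo 8 :=
  fun c hc hsm hcard => crossCount_le_topBotCount_of_card_le_eight' c hc hsm hcard

/-- **C-005 for every marked multigraph with at most `n` edges, given Lemma B for single-merge maps
on at most `n` coordinates**: every face map is a single-merge map on a subtype of the edge set. -/
theorem C005_of_card_le_of_lemmaB {n : ℕ} (hB : LemmaBSingleMergeUpTo n) {V E : Type} [Fintype E]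
    [DecidableEq E] (G : MultiGraph V E) (hE : Fintype.card E ≤ n) (p : E → ℝ) (hp : IsProb p)
    (a b c d : V) :
    prob p (G.partitionEvent ![a, b, c, d] ![0, 0, 1, 1]) *
        prob p (G.partitionEvent ![a, b, c, d] ![0, 1, 0, 1]) +
      prob p (G.partitionEvent ![a, b, c, d] ![0, 0, 1, 1]) *
        prob p (G.partitionEvent ![a, b, c, d] ![0, 1, 1, 0]) +
      prob p (G.partitionEvent ![a, b, c, d] ![0, 1, 0, 1]) *
        prob p (G.partitionEvent ![a, b, c, d] ![0, 1, 1, 0]) ≤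
    prob p (G.partitionEvent ![a, b, c, d] ![0, 0, 0, 0]) *
      prob p (G.partitionEvent ![a, b, c, d] ![0, 1, 2, 3]) := by
  classical
  have key : 0 ≤ nestedForm p (fun ω => G.markedPartition ω ![a, b, c, d])
      (fun ω => G.markedPartition ω ![a, b, c, d]) := by
    rw [nestedForm_self_eq_sum_faces]
    refine Finset.sum_nonneg fun uv _ => ?_
    refine mul_nonneg (mul_nonneg (weight_nonneg hp _) (weight_nonneg hp _)) ?_
    split_ifs with hle
    · set cf : Config (Face uv.1 uv.2) → Setoid (Fin 4) :=
        fun ρ => G.markedPartition (embed uv.1 uv.2 ρ) ![a, b, c, d] with hcf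
      have hsm : SingleMergeMap cf := G.singleMergeMap_class ![a, b, c, d] uv.1 uv.2
      have hmono : Monotone cf :=
        (G.monotone_markedPartition_four ![a, b, c, d]).comp (embed_mono uv.1 uv.2)
      have hcard : Fintype.card (Face uv.1 uv.2) ≤ n :=
        (Fintype.card_le_of_injective Subtype.val Subtype.val_injective).trans hE
      have hBf := hB cf hmono hsm hcard
      have h' : (crossCount cross4 cf : ℝ) ≤ topBotCount cf := by exact_mod_cast hBf
      have hsum := sum_crossKernel_compl cross4_injective cf
      rw [show (∑ ρ : Config (Face uv.1 uv.2), nestedKernel (cf ρ) (cf ρᶜ)) =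
        ∑ ρ : Config (Face uv.1 uv.2), crossKernel cross4 (cf ρ) (cf ρᶜ) from rfl, hsum]
      linarith
    · exact le_rfl
  rw [G.nestedForm_markedPartition] at key
  linarith

/-- **C-005 for every marked multigraph with at most nine edges**, given Lemma B for single-merge
maps on at most nine coordinates (SAT-certified, HOME/mining/p4/g5: UNSAT by kissat and cadical in
both symmetry-reduced cases, DRAT certificates j164396 / j164397; not yet a kernel theorem). -/
theorem C005_of_card_le_nine (hB : LemmaBSingleMergeUpTo 9) {V E : Type} [Fintype E]
    [DecidableEq E] (G : MultiGraph V E) (hE : Fintype.card E ≤ 9) (p : E → ℝ) (hp : IsProb p)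
    (a b c d : V) :
    prob p (G.partitionEvent ![a, b, c, d] ![0, 0, 1, 1]) *
        prob p (G.partitionEvent ![a, b, c, d] ![0, 1, 0, 1]) +
      prob p (G.partitionEvent ![a, b, c, d] ![0, 0, 1, 1]) *
        prob p (G.partitionEvent ![a, b, c, d] ![0, 1, 1, 0]) +
      prob p (G.partitionEvent ![a, b, c, d] ![0, 1, 0, 1]) *
        prob p (G.partitionEvent ![a, b, c, d] ![0, 1, 1, 0]) ≤
    prob p (G.partitionEvent ![a, b, c, d] ![0, 0, 0, 0]) *
      prob p (G.partitionEvent ![a, b, c, d] ![0, 1, 2, 3]) :=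
  C005_of_card_le_of_lemmaB hB G hE p hp a b c d

/-- **C-005 for every marked multigraph with at most ten edges**, given Lemma B for single-merge
maps on at most ten coordinates (the gen-7 symmetry-reduced cube-and-conquer with per-cube DRAT
certificates, HOME/mining/p4/g7; in progress when this file was written — not a kernel theorem). -/
theorem C005_of_card_le_ten (hB : LemmaBSingleMergeUpTo 10) {V E : Type} [Fintype E]
    [DecidableEq E] (G : MultiGraph V E) (hE : Fintype.card E ≤ 10) (p : E → ℝ) (hp : IsProb p)
    (a b c d : V) :
    prob p (G.partitionEvent ![a, b, c, d] ![0, 0, 1, 1]) *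
        prob p (G.partitionEvent ![a, b, c, d] ![0, 1, 0, 1]) +
      prob p (G.partitionEvent ![a, b, c, d] ![0, 0, 1, 1]) *
        prob p (G.partitionEvent ![a, b, c, d] ![0, 1, 1, 0]) +
      prob p (G.partitionEvent ![a, b, c, d] ![0, 1, 0, 1]) *
        prob p (G.partitionEvent ![a, b, c, d] ![0, 1, 1, 0]) ≤
    prob p (G.partitionEvent ![a, b, c, d] ![0, 0, 0, 0]) *
      prob p (G.partitionEvent ![a, b, c, d] ![0, 1, 2, 3]) :=
  C005_of_card_le_of_lemmaB hB G hE p hp a b c d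

/-- The eight-edge case of C-005, re-derived through the abstract statement (a sanity check that
`C005_of_card_le_of_lemmaB` specialises to the kernel theorem `C005_of_card_le_eight'`). -/
theorem C005_of_card_le_eight'' {V E : Type} [Fintype E] [DecidableEq E] (G : MultiGraph V E)
    (hE : Fintype.card E ≤ 8) (p : E → ℝ) (hp : IsProb p) (a b c d : V) :
    prob p (G.partitionEvent ![a, b, c, d] ![0, 0, 1, 1]) *
        prob p (G.partitionEvent ![a, b, c, d] ![0, 1, 0, 1]) +
      prob p (G.partitionEvent ![a, b, c, d] ![0, 0, 1, 1]) *
        prob p (G.partitionEvent ![a, b, c, d] ![0, 1, 1, 0]) +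
      prob p (G.partitionEvent ![a, b, c, d] ![0, 1, 0, 1]) *
        prob p (G.partitionEvent ![a, b, c, d] ![0, 1, 1, 0]) ≤
    prob p (G.partitionEvent ![a, b, c, d] ![0, 0, 0, 0]) *
      prob p (G.partitionEvent ![a, b, c, d] ![0, 1, 2, 3]) :=
  C005_of_card_le_of_lemmaB lemmaBSingleMergeUpTo_eight G hE p hp a b c d

end PercRepro
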